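import Mathlib
import Summits.Ventures.PercRepro2.MixChordSupport

/-!
# The `o`-class chord on the leaf and cut-vertex classes OF THE SUPPORT GRAPH
(blind cell PercRepro2, night-1 g23; proofs/NIGHT1-G23.md §2)

Through the support transport of MixChordSupport.lean (`nMixChord_normD_restrict_iff`,
`nMixChord_normDZ2_restrict_iff`), the class theorems of the `o`-row — `a₃` a leaf at a root or at `o`
(MixChordOLeafRoot.lean), `a₃` alone behind a cut vertex at `a₁` / `a₂` / `o` (MixChordOCutVertex.lean) —
apply whenever the class holds for the graph of the POSITIVE-WEIGHT edges: the extra edges at `a₃` may be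
present at weight `0` (the situation after the root-edge induction `dChord_of_beta1_of_base` has pinned
them).  Leaf hypothesis: `∀ e, a₃ ∈ ends e → e ≠ g → p e = 0` (`leafSupport ends a₃ g` is the finset of
the other edges); cut-vertex hypothesis: `CutVertexM9.CutVertex (restrictEnds S ends) side L v Rt` for a
finset `S` carrying every positive weight.

Own code; standard axioms.
-/

namespace Summit.Ventures.PercRepro2

open UnionCluster CovForm

namespace Mix

namespace Support

section Corollaries

open scoped Classical in
/-- The edges that are NOT «at `a₃` and different from `g`»: the support finset of an instance in which
`a₃` is a leaf through `g` up to zero-weight edges. -/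
noncomputable def leafSupport {V : Type*} {E : Type*} [Fintype E] (ends : E → Sym2 V) (a₃ : V) (g : E) :
    Finset E :=
  Finset.univ.filter fun e => ¬ (a₃ ∈ ends e ∧ e ≠ g)

variable {V : Type*} {E : Type*} [Fintype E] [DecidableEq E] [Fintype V] [DecidableEq V]
  {R : Type*} [Field R] [LinearOrder R] [IsStrictOrderedRing R]

variable (p : E → R) (ends : E → Sym2 V) {o a₁ a₂ a₃ : V} (b : V) {f g : E}

omit [DecidableEq E] [Fintype V] [DecidableEq V] in
/-- Membership in `leafSupport`. -/
lemma mem_leafSupport {e : E} : e ∈ leafSupport ends a₃ g ↔ ¬ (a₃ ∈ ends e ∧ e ≠ g) := by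
  classical
  simp [leafSupport]

omit [DecidableEq E] [Fintype V] [DecidableEq V] [LinearOrder R] [IsStrictOrderedRing R] in
/-- Every edge off `leafSupport ends a₃ g` has weight `0` under the support-leaf hypothesis. -/
lemma leafSupport_zero (hleaf : ∀ e, a₃ ∈ ends e → e ≠ g → p e = 0) :
    ∀ e, e ∉ leafSupport ends a₃ g → p e = 0 := by
  intro e he
  rw [mem_leafSupport, not_not] at he
  exact hleaf e he.1 he.2

omit [DecidableEq E] [Fintype V] [DecidableEq V] in
/-- `g` lies in its own leaf support. -/
lemma self_mem_leafSupport : g ∈ leafSupport ends a₃ g := by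
  rw [mem_leafSupport]
  exact fun h => h.2 rfl

omit [DecidableEq E] [Fintype V] [DecidableEq V] in
/-- The `o`-edge is not at `a₃`, hence lies in the leaf support. -/
lemma o_edge_mem_leafSupport (hf : ends f = s(o, a₁)) (ho : o ≠ a₃) (h31 : a₃ ≠ a₁) :
    f ∈ leafSupport ends a₃ g := by
  rw [mem_leafSupport]
  rintro ⟨h, -⟩
  rw [hf, Sym2.mem_iff] at h
  rcases h with h | h
  · exact ho h.symm
  · exact h31 h

omit [DecidableEq E] [Fintype V] [DecidableEq V] in
/-- In the restricted graph, `g` is literally the only edge at `a₃`. -/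
lemma leaf_restrict (hgS : g ∈ leafSupport ends a₃ g) :
    ∀ e : {e // e ∈ leafSupport ends a₃ g}, a₃ ∈ restrictEnds (leafSupport ends a₃ g) ends e →
      e = ⟨g, hgS⟩ := by
  intro e he
  have h := (mem_leafSupport ends).1 e.2
  refine Subtype.ext ?_
  by_contra hne
  exact h ⟨he, hne⟩

omit [Fintype E] [DecidableEq E] [Fintype V] [DecidableEq V] [IsStrictOrderedRing R] in
/-- Restricted weights stay admissible. -/
lemma isProbVec_restrict (S : Finset E) (hp : IsProbVec p) : IsProbVec (restrict S p) :=
  ⟨fun e => hp.nonneg e, fun e => hp.le_one e⟩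

/-- **The `o`-class `D`-chord along `{o, a₁}` whenever `a₃` is a leaf at either root IN THE SUPPORT
GRAPH** (every other edge at `a₃` has weight `0`). -/
theorem dChord_o_edge_of_leaf_either_root_support (hp : IsProbVec p) (hf : ends f = s(o, a₁))
    (hg : ends g = s(a₃, a₂) ∨ ends g = s(a₃, a₁)) (hleaf : ∀ e, a₃ ∈ ends e → e ≠ g → p e = 0)
    (h32 : a₃ ≠ a₂) (h31 : a₃ ≠ a₁) (ho : o ≠ a₃) (hb : b ≠ a₃) :
    NMixChord (normD ends a₁ a₂ a₃) p ends o a₁ a₂ a₃ b f := by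
  have hS := leafSupport_zero p ends hleaf
  have hfS := o_edge_mem_leafSupport ends (g := g) hf ho h31
  rw [nMixChord_normD_restrict_iff _ hS ends o a₁ a₂ a₃ b hfS]
  exact dChord_o_edge_of_leaf_either_root _ _ b (isProbVec_restrict p _ hp) hf
    (g := ⟨g, self_mem_leafSupport ends⟩) hg (leaf_restrict ends _) h32 h31 ho hb

/-- **The `o`-class `D`-chord along `{o, a₁}` whenever `a₃` is a leaf at `o` in the support graph.** -/
theorem dChord_o_edge_of_leaf_o_support (hp : IsProbVec p) (hf : ends f = s(o, a₁))
    (hg : ends g = s(a₃, o)) (hleaf : ∀ e, a₃ ∈ ends e → e ≠ g → p e = 0)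
    (h3o : a₃ ≠ o) (h31 : a₃ ≠ a₁) (h32 : a₃ ≠ a₂) (hb : b ≠ a₃) :
    NMixChord (normD ends a₁ a₂ a₃) p ends o a₁ a₂ a₃ b f := by
  have hS := leafSupport_zero p ends hleaf
  have hfS := o_edge_mem_leafSupport ends (g := g) hf h3o.symm h31
  rw [nMixChord_normD_restrict_iff _ hS ends o a₁ a₂ a₃ b hfS]
  exact dChord_o_edge_of_leaf_o _ _ b (isProbVec_restrict p _ hp) hf
    (g := ⟨g, self_mem_leafSupport ends⟩) hg (leaf_restrict ends _) h3o h31 h32 hb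

/-- **The chain's row `(D·Z)²`-chord along `{o, a₁}`, `a₃` a leaf at either root in the support graph.** -/
theorem dz2Chord_o_edge_of_leaf_either_root_support (hp : IsProbVec p) (hf : ends f = s(o, a₁))
    (hg : ends g = s(a₃, a₂) ∨ ends g = s(a₃, a₁)) (hleaf : ∀ e, a₃ ∈ ends e → e ≠ g → p e = 0)
    (h32 : a₃ ≠ a₂) (h31 : a₃ ≠ a₁) (ho : o ≠ a₃) (hb : b ≠ a₃) :
    NMixChord (normDZ2 ends a₁ a₂ a₃) p ends o a₁ a₂ a₃ b f := by
  have hS := leafSupport_zero p ends hleaf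
  have hfS := o_edge_mem_leafSupport ends (g := g) hf ho h31
  rw [nMixChord_normDZ2_restrict_iff _ hS ends o a₁ a₂ a₃ b hfS]
  exact dz2Chord_o_edge_of_leaf_either_root _ _ b (isProbVec_restrict p _ hp) hf
    (g := ⟨g, self_mem_leafSupport ends⟩) hg (leaf_restrict ends _) h32 h31 ho hb

/-- **The chain's row along `{o, a₁}`, `a₃` a leaf at `o` in the support graph.** -/
theorem dz2Chord_o_edge_of_leaf_o_support (hp : IsProbVec p) (hf : ends f = s(o, a₁))
    (hg : ends g = s(a₃, o)) (hleaf : ∀ e, a₃ ∈ ends e → e ≠ g → p e = 0)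
    (h3o : a₃ ≠ o) (h31 : a₃ ≠ a₁) (h32 : a₃ ≠ a₂) (hb : b ≠ a₃) :
    NMixChord (normDZ2 ends a₁ a₂ a₃) p ends o a₁ a₂ a₃ b f := by
  have hS := leafSupport_zero p ends hleaf
  have hfS := o_edge_mem_leafSupport ends (g := g) hf h3o.symm h31
  rw [nMixChord_normDZ2_restrict_iff _ hS ends o a₁ a₂ a₃ b hfS]
  exact dz2Chord_o_edge_of_leaf_o _ _ b (isProbVec_restrict p _ hp) hf
    (g := ⟨g, self_mem_leafSupport ends⟩) hg (leaf_restrict ends _) h3o h31 h32 hb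

end Corollaries

section CutVertexSupport

variable {V : Type*} {E : Type*} [Fintype E] [DecidableEq E] [Fintype V] [DecidableEq V]
  {R : Type*} [Field R] [LinearOrder R] [IsStrictOrderedRing R]

variable (S : Finset E) {p : E → R} (hS : ∀ e, e ∉ S → p e = 0) (ends : E → Sym2 V)
  {side : {e // e ∈ S} → Bool} {L : Set V} {v : V} {Rt : Set V}

include hS

/-- **The cut-vertex class in the support graph** (`a₃` alone behind the cut vertex `v = a₂` of the
graph of the positive-weight edges `S`): the `o`-class `D`-chord along `{o, a₁}`. -/
theorem dChord_o_edge_a3_behind_a2_support (h : CutVertexM9.CutVertex (restrictEnds S ends) side L v Rt)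
    (hp : IsProbVec p) {o a₁ a₃ b : V} (hw : a₃ ∈ L) (ho : o ∈ Rt ∨ o = v) (h1 : a₁ ∈ Rt ∨ a₁ = v)
    (hb : b ∈ Rt ∨ b = v) {f : E} (hfS : f ∈ S) (hf : ends f = s(o, a₁)) (ho1 : o ≠ a₁) :
    NMixChord (normD ends a₁ v a₃) p ends o a₁ v a₃ b f := by
  rw [nMixChord_normD_restrict_iff S hS ends o a₁ v a₃ b hfS]
  exact dChord_o_edge_a3_behind_a2 h (isProbVec_restrict p S hp) hw ho h1 hb
    (f := ⟨f, hfS⟩) hf ho1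

/-- The same behind the cut vertex `v = a₁`. -/
theorem dChord_o_edge_a3_behind_a1_support (h : CutVertexM9.CutVertex (restrictEnds S ends) side L v Rt)
    (hp : IsProbVec p) {o a₂ a₃ b : V} (hw : a₃ ∈ L) (ho : o ∈ Rt ∨ o = v) (h2 : a₂ ∈ Rt ∨ a₂ = v)
    (hb : b ∈ Rt ∨ b = v) {f : E} (hfS : f ∈ S) (hf : ends f = s(o, v)) (ho1 : o ≠ v) :
    NMixChord (normD ends v a₂ a₃) p ends o v a₂ a₃ b f := by
  rw [nMixChord_normD_restrict_iff S hS ends o v a₂ a₃ b hfS]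
  exact dChord_o_edge_a3_behind_a1 h (isProbVec_restrict p S hp) hw ho h2 hb
    (f := ⟨f, hfS⟩) hf ho1

/-- The same behind the cut vertex `v = o`. -/
theorem dChord_o_edge_a3_behind_o_support (h : CutVertexM9.CutVertex (restrictEnds S ends) side L v Rt)
    (hp : IsProbVec p) {a₁ a₂ a₃ b : V} (hw : a₃ ∈ L) (h1 : a₁ ∈ Rt ∨ a₁ = v) (h2 : a₂ ∈ Rt ∨ a₂ = v)
    (hb : b ∈ Rt ∨ b = v) {f : E} (hfS : f ∈ S) (hf : ends f = s(v, a₁)) (ho1 : v ≠ a₁) :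
    NMixChord (normD ends a₁ a₂ a₃) p ends v a₁ a₂ a₃ b f := by
  rw [nMixChord_normD_restrict_iff S hS ends v a₁ a₂ a₃ b hfS]
  exact dChord_o_edge_a3_behind_o h (isProbVec_restrict p S hp) hw h1 h2 hb
    (f := ⟨f, hfS⟩) hf ho1

/-- The chain's row behind the cut vertex `v = a₂` in the support graph. -/
theorem dz2Chord_o_edge_a3_behind_a2_support (h : CutVertexM9.CutVertex (restrictEnds S ends) side L v Rt)
    (hp : IsProbVec p) {o a₁ a₃ b : V} (hw : a₃ ∈ L) (ho : o ∈ Rt ∨ o = v) (h1 : a₁ ∈ Rt ∨ a₁ = v)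
    (hb : b ∈ Rt ∨ b = v) {f : E} (hfS : f ∈ S) (hf : ends f = s(o, a₁)) (ho1 : o ≠ a₁) :
    NMixChord (normDZ2 ends a₁ v a₃) p ends o a₁ v a₃ b f := by
  rw [nMixChord_normDZ2_restrict_iff S hS ends o a₁ v a₃ b hfS]
  exact dz2Chord_o_edge_a3_behind_a2 h (isProbVec_restrict p S hp) hw ho h1 hb
    (f := ⟨f, hfS⟩) hf ho1

end CutVertexSupport

end Support

end Mix

end Summit.Ventures.PercRepro2
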